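import Literature.AlgebraicGeometry.HodgeTheory.BettiKunnethPiecesJointActionCriteria
import Literature.AlgebraicGeometry.HodgeTheory.BettiKunnethPiecesHardLefschetzReduction
import Literature.AlgebraicGeometry.HodgeTheory.BettiHodgeConjectureSquareOffMiddleAlgebraic
import Literature.AlgebraicGeometry.HodgeTheory.ProductFactorsHodgeDescent
import HarnessLib

/-!
# `HC(Y × Z)` for ALL smooth projective `Y` (`dim m`), `Z` (`dim n`): the JOINT criterion on the REDUCED window — given `HC(Y)`, `HC(Z)`, `HC(Y × Z)` ⟺ in each degree `2c` (`2 ≤ c`, `2c ≤ m + n`) every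
# family of morphisms of `ℚ`-Hodge structures `φ_{ij} : H^{2n−j}(Z) → Hⁱ(Y)(c − n)` over the pieces `1 ≤ i ≤ m`, `1 ≤ j ≤ n`, `bᵢ(Y) ≠ 0`, `bⱼ(Z) ≠ 0`, no factor of Hodge classes, is JOINTLY induced by one
# rational algebraic class of `H^{2c}(Y × Z)` (Voisin I §11.3.3 Thm. 11.38–11.40, Lemma 11.41, pp. 285–287; §6.2.3 Thm. 6.25; §7.3.2 Lemma 7.28; Thm. 11.30; Deligne Hodge II 2.1.13; Voisin II Prop. 9.20; Arapura Lemma 4.2)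

Family `hodge`, lane `lit-hodgefound` (Track 2 foundations library; Layers A1/A4), layer `Literature/AlgebraicGeometry/HodgeTheory`.  THEOREMS ONLY (no definition, no named fact, no instance;
D-0026 net debt `0`).  The seat's g31-#10 (joint criterion on the window `1 ≤ i ≤ m`, `1 ≤ j ≤ n`) with the window REDUCED as in g31-#14: a window piece `Hⁱ(Y) ⊗ Hʲ(Z)` with a zero factor is
zero (tree `…_of_finrank_eq_zero`), and one with a factor consisting of Hodge classes (`i = 2a`, `Hdgᵃ(H^{2a}(Y)) = H^{2a}(Y;ℚ)`, or `j = 2b` likewise) has Hodge classes `H^{2a}(Y) ⊗ Hdgᵇ(H^{2b}(Z))`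
(Deligne 2.1.13) with algebraic exterior products (tree `…_of_hodgeClasses_eq_top_left/right`); both are FREE in the sense of g31-#6 (the joint criterion relative to a set of pieces with free
complement), as are the pieces outside the window (`HC(Z)`, `HC(Y)`, hard Lefschetz on either factor by strong induction on `c`, Lefschetz `(1,1)`).  So the JOINT families need only range over the
reduced window; by Lemma 11.41 with integer twists (g31-#2, g31-#6 §2) the Hodge families of those pieces are exactly the families of morphisms of Hodge structures
`φ_{ij} ∈ Hom_HS(H^{2n−j}(Z), Hⁱ(Y)(c − n))`.

WHAT IS PROVED.
* §1 (any orientation family `μ`) **`BettiUniverse.tensor_forall_hodgeClasses_algebraic_of_joint_corrAction_reducedWindow`**, **`BettiUniverse.hodgeConjectureFor_tensor_iff_forall_kunneth_reducedWindow_family_exists_algebraic`**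
  — given `HC(Y)`, `HC(Z)`: all Hodge classes of `Y × Z` are algebraic iff (⟸ / ⟺) every Hodge family is jointly matched on the reduced window by one algebraic class.
* §2 (complex orientations) **`BettiUniverse.hodgeConjectureFor_tensor_iff_forall_hom_reducedWindow_family_exists_algebraic`** — given `HC(Y)`, `HC(Z)`: `HC(Y × Z)` ⟺ every reduced-window family of
  Hodge morphisms is jointly induced by a rational class with algebraic complexification.
* §3 **`BettiUniverse.hodgeConjectureFor_tensor_iff_factors_and_forall_hom_reducedWindow_family_exists_algebraic`** — `HC(Y × Z)` ⟺ `HC(Y) ∧ HC(Z) ∧` the criterion of §2.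

THE PRINTS.  C. Voisin (2002) [VoisinHodgeI2002] §6.2.3 Thm. 6.25, Rem. 6.27; §7.3.1 Def. 7.22; §7.3.2 Lemma 7.28, Rem. 7.29; §11.3.1 Thm. 11.30; §11.3.3 Thm. 11.38–11.40, Lemma 11.41 and pp. 285–287.
P. Deligne (1971) [DeligneHodgeII1971] 2.1.13.  C. Voisin (2003) [VoisinHodgeII2003] §9.2.4 Prop. 9.20.  C. Voisin (2025) [Voisin2025] §3.2.1 (12)–(14), Prop. 3.8, Cor. 3.9.  D. Arapura (2006) [Arapura2006]
§4 Lemma 4.2, §1 Cor. 1.2.  A. Hatcher (2002) [HatcherAT2002] §3.2 Thm. 3.15–3.16.  P. Deligne (2000/2006) [Deligne2000] §1.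

THE OBJECTS (all the tree's).  `BettiUniverse.KunnethSrc`, `BettiUniverse.kunnethSummand`, `BettiUniverse.kunnethMap`, `BettiUniverse.crossMap`, `BettiUniverse.hodge`, `corrAction μ`, `HodgeStructure.Hom`,
`tateTwist` (`r : ℤ`), `cast`, `hodgeClasses`, `ofRatClass`, `algebraicClasses`, `bettiCohomology`, `Module.finrank`, `HodgeConjectureFor`; the seat's g31-#6 `BettiUniverse.forall_hodgeClasses_algebraic_of_joint_corrAction`,
`BettiUniverse.joint_corrAction_iff_joint_hom_tateTwist_int`, g31-#5 `BettiUniverse.corrAction_kunnethMap_eq`, the tree's `…ofRatClass_crossMap_mem_algebraicClasses_of_lefschetzRange/_of_lt/_of_fst_zero/_of_snd_zero/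
_of_hardLefschetz_left/_of_hardLefschetz_right/_of_finrank_eq_zero/_of_hodgeClasses_eq_top_left/_of_hodgeClasses_eq_top_right`, `BettiUniverse.crossMap_mem_hodgeClasses`, `BettiUniverse.kunnethMap_mem_hodgeClasses_iff`,
`BettiUniverse.kunnethMap_apply`, `hodgeConjectureFor_of_tensor_left/right`, `IsSmoothProjective.tensor_holds`, `hodgeConjectureFor_iff_of_hodgeModel`, `BettiUniverse.forall_mem_hodgeClasses_hodge_iff`.

DEVIATIONS / SCOPE.  §1 for any orientation family; §2–§3 complex orientations.  No definitions.

## References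
* [VoisinHodgeI2002] C. Voisin, *Hodge Theory and Complex Algebraic Geometry I* (2002) — §6.2.3 Thm. 6.25, Rem. 6.27; §7.3.1 Def. 7.22; §7.3.2 Lemma 7.28, Rem. 7.29; §11.3.1 Thm. 11.30; §11.3.3 Thm. 11.38–11.40, Lemma 11.41, pp. 285–287.
* [DeligneHodgeII1971] P. Deligne, *Théorie de Hodge II* (1971) — 2.1.13.
* [VoisinHodgeII2003] C. Voisin, *Hodge Theory and Complex Algebraic Geometry II* (2003) — §9.2.4 Prop. 9.20.
* [Voisin2025] C. Voisin, *Cycle classes on algebraic varieties* (2025) — §3.2.1 (12)–(14), Prop. 3.8, Cor. 3.9.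
* [Arapura2006] D. Arapura, *Motivation for Hodge cycles* (2006) — §4 Lemma 4.2, §1 Cor. 1.2.
* [HatcherAT2002] A. Hatcher, *Algebraic Topology* (2002) — §3.2 Thm. 3.15–3.16.
* [Deligne2000] P. Deligne, *The Hodge conjecture* (Clay problem description) — §1.

## Provenance
Lane `lit-hodgefound` (Hodge path, Track 2), prover seat `lit-hodgefound-p29` (generation 31), self-proposed row g31-#15 (two factors of arbitrary dimensions: the joint `Hom_HS`-family criterion on
the reduced window).
-/

noncomputable section

open scoped TensorProduct
open CategoryTheory MonoidalCategory CartesianMonoidalCategory Module Finset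
open Literature.AlgebraicTopology.SingularHomology
open Literature.Geometry.Kaehler

namespace Literature.AlgebraicGeometry.HodgeTheory

open Literature.AlgebraicGeometry.Motives
open Literature.AlgebraicGeometry.Motives.HodgeStructure

variable {m n d : ℕ} {Y Z : SchemeOver ℂ}

section Joint

variable [HodgeTensorFacts.{0, 0}] (μ : OrientationFamily)

/-! ### §1 The joint criterion on the reduced window: all degrees, by strong induction on `c` -/

/-- **Two factors of arbitrary dimensions, reduced window, all degrees.**  Let `Y` (`dim m`), `Z` (`dim n`) be smooth projective with `HC(Y)`, `HC(Z)`, and suppose that for every `c` with `2 ≤ c`,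
`2c ≤ m + n` and every family `(t_{ij})` of Hodge classes of the Künneth summands of `H^{2c}(Y × Z)` there is a rational class `γ` with `γ ⊗ 1` algebraic acting on `H^{2n−j}(Z;ℂ)` as
`crossMap t_{ij} ⊗ 1` for every REDUCED-window piece: `1 ≤ i ≤ m`, `1 ≤ j ≤ n`, `bᵢ(Y) ≠ 0`, `bⱼ(Z) ≠ 0`, `Hdgᵃ(H^{2a}(Y)) ≠ H^{2a}(Y;ℚ)` when `i = 2a`, `Hdgᵇ(H^{2b}(Z)) ≠ H^{2b}(Z;ℚ)` when `j = 2b`.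
Then EVERY Hodge class of EVERY `H^{2c}(Y × Z)` is algebraic (the complement of the reduced window is free: zero pieces, pure pieces with algebraic exterior products, `HC(Z)`/`HC(Y)` at `i = 0`/`j = 0`,
hard Lefschetz on `Y`/`Z` for `i > m`/`j > n` by induction, Lefschetz `(1,1)`; then g31-#6). [cite: VoisinHodgeI2002, §6.2.3 Thm. 6.25, Rem. 6.27, §11.3.1 Thm. 11.30, §11.3.3 Thm. 11.38–11.40, Lemma 11.41 and pp. 285–287]
[cite: DeligneHodgeII1971, 2.1.13] [cite: VoisinHodgeII2003, §9.2.4 Prop. 9.20] [cite: Voisin2025, §3.2.1 (12)–(14), Prop. 3.8 and Cor. 3.9] -/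
theorem BettiUniverse.tensor_forall_hodgeClasses_algebraic_of_joint_corrAction_reducedWindow (hHD : exists_isReal_hodgeModel) (hY : IsSmoothProjective m Y) (hZ : IsSmoothProjective n Z)
    (hYZ : IsSmoothProjective d (Y ⊗ Z)) (hHCY : HodgeConjectureFor m Y) (hHCZ : HodgeConjectureFor n Z)
    (hJ : ∀ c : ℕ, 2 ≤ c → 2 * c ≤ m + n → ∀ t : BettiUniverse.KunnethSrc Y Z (2 * c), (∀ ij, t ij ∈ (BettiUniverse.kunnethSummand hHD hY hZ (2 * c) ij).hodgeClasses c) →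
      ∃ γ : bettiCohomology (Y ⊗ Z) (2 * c), ofRatClass (ComplexPoints (Y ⊗ Z)) (2 * c) γ ∈ algebraicClasses (Y ⊗ Z) c ∧
        ∀ (i j a : ℕ) (hij : i + j = 2 * c) (_haj : a + j = 2 * n) (hab : a + 2 * c = i + 2 * n), 1 ≤ i → i ≤ m → 1 ≤ j → j ≤ n →
          0 < Module.finrank ℚ (bettiCohomology Y i) → 0 < Module.finrank ℚ (bettiCohomology Z j) →
          (∀ a', i = 2 * a' → (BettiUniverse.hodge hHD hY (2 * a')).hodgeClasses a' ≠ ⊤) → (∀ b', j = 2 * b' → (BettiUniverse.hodge hHD hZ (2 * b')).hodgeClasses b' ≠ ⊤) →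
          corrAction μ hY hZ hab (ofRatClass (ComplexPoints (Y ⊗ Z)) (2 * c) γ) =
            corrAction μ hY hZ hab (ofRatClass (ComplexPoints (Y ⊗ Z)) (2 * c) (BettiUniverse.crossMap Y Z hij (t ⟨(i, j), HasAntidiagonal.mem_antidiagonal.2 hij⟩))))
    (c : ℕ) : ∀ v ∈ (BettiUniverse.hodge hHD hYZ (2 * c)).hodgeClasses c, ofRatClass (ComplexPoints (Y ⊗ Z)) (2 * c) v ∈ algebraicClasses (Y ⊗ Z) c := by
  have hI := hodgePQ_independent_of_hodgeModel_holds
  have hHCYc : ∀ c' : ℕ, ∀ y ∈ (BettiUniverse.hodge hHD hY (2 * c')).hodgeClasses c', ofRatClass (ComplexPoints Y) (2 * c') y ∈ algebraicClasses Y c' :=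
    fun c' y hy ↦ hHCY.2 c' _ (isRationalClass_ofRatClass _) ((BettiUniverse.mem_hodgeClasses_hodge_iff_isOfHodgeType hHD hY c' y).1 hy)
  have hHCZc : ∀ c' : ℕ, ∀ z ∈ (BettiUniverse.hodge hHD hZ (2 * c')).hodgeClasses c', ofRatClass (ComplexPoints Z) (2 * c') z ∈ algebraicClasses Z c' :=
    fun c' z hz ↦ hHCZ.2 c' _ (isRationalClass_ofRatClass _) ((BettiUniverse.mem_hodgeClasses_hodge_iff_isOfHodgeType hHD hZ c' z).1 hz)
  induction c using Nat.strong_induction_on with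
  | _ c IH =>
  refine BettiUniverse.forall_hodgeClasses_algebraic_of_joint_corrAction μ hHD hY hZ hYZ
    (fun j ↦ (2 ≤ c ∧ 2 * c ≤ m + n) ∧ (1 ≤ j ∧ j ≤ n) ∧ 0 < Module.finrank ℚ (bettiCohomology Z j) ∧ (∀ b', j = 2 * b' → (BettiUniverse.hodge hHD hZ (2 * b')).hodgeClasses b' ≠ ⊤) ∧
      ∀ i', i' + j = 2 * c → (1 ≤ i' ∧ i' ≤ m) ∧ 0 < Module.finrank ℚ (bettiCohomology Y i') ∧ ∀ a', i' = 2 * a' → (BettiUniverse.hodge hHD hY (2 * a')).hodgeClasses a' ≠ ⊤)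
    (fun i j hij hP u hu ↦ ?_) (fun t ht ↦ ?_)
  · -- the free complement of the reduced window
    by_cases hc1 : c ≤ 1
    · exact BettiUniverse.ofRatClass_crossMap_mem_algebraicClasses_of_lefschetzRange hHD hY hZ hYZ hij (Or.inl hc1) hu
    by_cases hi2 : 2 * m < i
    · exact BettiUniverse.ofRatClass_crossMap_mem_algebraicClasses_of_lt hY hZ hij (Or.inl hi2) u
    by_cases hj2 : 2 * n < j
    · exact BettiUniverse.ofRatClass_crossMap_mem_algebraicClasses_of_lt hY hZ hij (Or.inr hj2) u
    by_cases him : m < i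
    · -- `m < i ≤ 2m`: hard Lefschetz on `Y` down to degree `2(c + m − i) < 2c`
      exact BettiUniverse.ofRatClass_crossMap_mem_algebraicClasses_of_hardLefschetz_left hHD hY hZ hYZ (i₀ := 2 * m - i) (s := i - m) (c₀ := c + m - i) (by omega) (by omega) (by omega) hij
        (fun w hw ↦ IH (c + m - i) (by omega) _ (BettiUniverse.crossMap_mem_hodgeClasses hHD hI hY hZ hYZ _ _ hw)) hu
    by_cases hjn : n < j
    · -- `n < j ≤ 2n`: hard Lefschetz on `Z` down to degree `2(c + n − j) < 2c`
      exact BettiUniverse.ofRatClass_crossMap_mem_algebraicClasses_of_hardLefschetz_right hHD hY hZ hYZ (j₀ := 2 * n - j) (s := j - n) (c₀ := c + n - j) (by omega) (by omega) (by omega) hij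
        (fun w hw ↦ IH (c + n - j) (by omega) _ (BettiUniverse.crossMap_mem_hodgeClasses hHD hI hY hZ hYZ _ _ hw)) hu
    by_cases hi0 : i = 0
    · subst hi0
      exact BettiUniverse.ofRatClass_crossMap_mem_algebraicClasses_of_fst_zero hHD hY hZ hij (hHCZc c) hu
    by_cases hj0 : j = 0
    · subst hj0
      exact BettiUniverse.ofRatClass_crossMap_mem_algebraicClasses_of_snd_zero hHD hY hZ hij (hHCYc c) hu
    -- inside the window: a zero factor
    by_cases h0 : Module.finrank ℚ (bettiCohomology Y i) = 0 ∨ Module.finrank ℚ (bettiCohomology Z j) = 0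
    · exact BettiUniverse.ofRatClass_crossMap_mem_algebraicClasses_of_finrank_eq_zero hY hZ hij h0 u
    -- a first factor of Hodge classes
    by_cases hpY : ∃ a', i = 2 * a' ∧ (BettiUniverse.hodge hHD hY (2 * a')).hodgeClasses a' = ⊤
    · obtain ⟨a', rfl, htop⟩ := hpY
      obtain ⟨b', rfl⟩ : ∃ b', j = 2 * b' := ⟨c - a', by omega⟩
      exact BettiUniverse.ofRatClass_crossMap_mem_algebraicClasses_of_hodgeClasses_eq_top_left hHD hY hZ hij htop (fun w ↦ hHCYc a' w (by rw [htop]; exact Submodule.mem_top)) (hHCZc b') hu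
    -- a second factor of Hodge classes
    by_cases hpZ : ∃ b', j = 2 * b' ∧ (BettiUniverse.hodge hHD hZ (2 * b')).hodgeClasses b' = ⊤
    · obtain ⟨b', rfl, htop⟩ := hpZ
      obtain ⟨a', rfl⟩ : ∃ a', i = 2 * a' := ⟨c - b', by omega⟩
      exact BettiUniverse.ofRatClass_crossMap_mem_algebraicClasses_of_hodgeClasses_eq_top_right hHD hY hZ hij htop (hHCYc a') (fun w ↦ hHCZc b' w (by rw [htop]; exact Submodule.mem_top)) hu
    · -- what is left is the reduced window
      refine absurd ⟨⟨by omega, by omega⟩, ⟨by omega, by omega⟩, Nat.pos_of_ne_zero (not_or.1 h0).2, fun b' hjb htop ↦ hpZ ⟨b', hjb, htop⟩, fun i' hi' ↦ ?_⟩ hP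
      obtain rfl : i' = i := by omega
      exact ⟨⟨by omega, by omega⟩, Nat.pos_of_ne_zero (not_or.1 h0).1, fun a' hia htop ↦ hpY ⟨a', hia, htop⟩⟩
  · -- the joint criterion on the reduced window
    by_cases hc : 2 ≤ c ∧ 2 * c ≤ m + n
    · obtain ⟨γ, hγ, hact⟩ := hJ c hc.1 hc.2 t ht
      refine ⟨γ, hγ, fun i j a hij haj hab hP ↦ ?_⟩
      have E := hP.2.2.2.2 i hij
      exact hact i j a hij haj hab E.1.1 E.1.2 hP.2.1.1 hP.2.1.2 E.2.1 hP.2.2.1 E.2.2 hP.2.2.2.1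
    · exact ⟨0, by rw [map_zero]; exact Submodule.zero_mem _, fun i j a hij haj hab hP ↦ absurd hP.1 hc⟩

/-- **Given `HC(Y)` and `HC(Z)`: `HC(Y × Z)` ⟺ for every `c` with `2 ≤ c`, `2c ≤ m + n`, every family of Hodge classes of the Künneth summands of `H^{2c}(Y × Z)` is JOINTLY matched on the reduced
window by one rational class with algebraic complexification** («⇒»: `γ = Σ crossMap t_{ij}`; «⇐»: the previous theorem). [cite: VoisinHodgeI2002, §11.3.3 Thm. 11.38–11.40, Lemma 11.41 and pp. 285–287, §6.2.3 Thm. 6.25, §11.3.1 Thm. 11.30]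
[cite: DeligneHodgeII1971, 2.1.13] [cite: Voisin2025, §3.2.1 (12)–(14), Prop. 3.8 and Cor. 3.9] [cite: Deligne2000, §1] -/
theorem BettiUniverse.hodgeConjectureFor_tensor_iff_forall_kunneth_reducedWindow_family_exists_algebraic (hHD : exists_isReal_hodgeModel) (hY : IsSmoothProjective m Y) (hZ : IsSmoothProjective n Z)
    (hYZ : IsSmoothProjective d (Y ⊗ Z)) (hHCY : HodgeConjectureFor m Y) (hHCZ : HodgeConjectureFor n Z) :
    HodgeConjectureFor d (Y ⊗ Z) ↔
      ∀ c : ℕ, 2 ≤ c → 2 * c ≤ m + n → ∀ t : BettiUniverse.KunnethSrc Y Z (2 * c), (∀ ij, t ij ∈ (BettiUniverse.kunnethSummand hHD hY hZ (2 * c) ij).hodgeClasses c) →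
        ∃ γ : bettiCohomology (Y ⊗ Z) (2 * c), ofRatClass (ComplexPoints (Y ⊗ Z)) (2 * c) γ ∈ algebraicClasses (Y ⊗ Z) c ∧
          ∀ (i j a : ℕ) (hij : i + j = 2 * c) (_haj : a + j = 2 * n) (hab : a + 2 * c = i + 2 * n), 1 ≤ i → i ≤ m → 1 ≤ j → j ≤ n →
            0 < Module.finrank ℚ (bettiCohomology Y i) → 0 < Module.finrank ℚ (bettiCohomology Z j) →
            (∀ a', i = 2 * a' → (BettiUniverse.hodge hHD hY (2 * a')).hodgeClasses a' ≠ ⊤) → (∀ b', j = 2 * b' → (BettiUniverse.hodge hHD hZ (2 * b')).hodgeClasses b' ≠ ⊤) →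
            corrAction μ hY hZ hab (ofRatClass (ComplexPoints (Y ⊗ Z)) (2 * c) γ) =
              corrAction μ hY hZ hab (ofRatClass (ComplexPoints (Y ⊗ Z)) (2 * c) (BettiUniverse.crossMap Y Z hij (t ⟨(i, j), HasAntidiagonal.mem_antidiagonal.2 hij⟩))) := by
  have hI := hodgePQ_independent_of_hodgeModel_holds
  constructor
  · intro hHC c _ _ t ht
    have hall : ∀ v ∈ (BettiUniverse.hodge hHD hYZ (2 * c)).hodgeClasses c, ofRatClass (ComplexPoints (Y ⊗ Z)) (2 * c) v ∈ algebraicClasses (Y ⊗ Z) c :=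
      fun v hv ↦ hHC.2 c _ (isRationalClass_ofRatClass _) ((BettiUniverse.mem_hodgeClasses_hodge_iff_isOfHodgeType hHD hYZ c v).1 hv)
    refine ⟨BettiUniverse.kunnethMap Y Z (2 * c) t, hall _ ((BettiUniverse.kunnethMap_mem_hodgeClasses_iff hHD hI hY hZ hYZ (2 * c) c t).2 ht), fun i j a hij _ hab _ _ _ _ _ _ _ _ ↦ ?_⟩
    rw [BettiUniverse.kunnethMap_apply, BettiUniverse.corrAction_kunnethMap_eq μ hY hZ hij hab t]
  · intro h
    rw [hodgeConjectureFor_iff_of_hodgeModel (BettiUniverse.realHodgeModel hHD hYZ)]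
    intro c
    rw [← BettiUniverse.forall_mem_hodgeClasses_hodge_iff hHD hYZ c]
    exact BettiUniverse.tensor_forall_hodgeClasses_algebraic_of_joint_corrAction_reducedWindow μ hHD hY hZ hYZ hHCY hHCZ h c

end Joint

/-! ### §2 The reduced-window criterion on families of morphisms of Hodge structures -/

section JointHom

variable [HodgeTensorFacts.{0, 0}]

/-- **`HC(Y × Z)` for smooth projective `Y` (`dim m`), `Z` (`dim n`) with `HC(Y)`, `HC(Z)` IFF for every `c` with `2 ≤ c`, `2c ≤ m + n` (`n + r = c`) every REDUCED-window family of morphisms of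
`ℚ`-Hodge structures `φ_{ij} : H^{2n−j}(Z) → Hⁱ(Y)(r)` — `1 ≤ i ≤ m`, `1 ≤ j ≤ n`, `i + j = 2c`, `bᵢ(Y) ≠ 0`, `bⱼ(Z) ≠ 0`, `Hdgᵃ(H^{2a}(Y)) ≠ H^{2a}(Y;ℚ)` when `i = 2a`, `Hdgᵇ(H^{2b}(Z)) ≠ H^{2b}(Z;ℚ)` when
`j = 2b` — is JOINTLY induced by a rational class `γ ∈ H^{2c}(Y × Z;ℚ)` with `γ ⊗ 1` algebraic** (complex orientations; §1 and Lemma 11.41 with integer twists, g31-#6 §2).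
[cite: VoisinHodgeI2002, §7.3.1 Def. 7.22, §7.3.2, §11.3.3 Thm. 11.38–11.40, Lemma 11.41 and pp. 285–287, §6.2.3 Thm. 6.25, §11.3.1 Thm. 11.30] [cite: DeligneHodgeII1971, 2.1.13] [cite: Voisin2025, §3.2.1 (12)–(14), Prop. 3.8 and Cor. 3.9]
[cite: Deligne2000, §1] -/
theorem BettiUniverse.hodgeConjectureFor_tensor_iff_forall_hom_reducedWindow_family_exists_algebraic (hHD : exists_isReal_hodgeModel) (hY : IsSmoothProjective m Y) (hZ : IsSmoothProjective n Z)
    (hYZ : IsSmoothProjective d (Y ⊗ Z)) (hHCY : HodgeConjectureFor m Y) (hHCZ : HodgeConjectureFor n Z) :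
    HodgeConjectureFor d (Y ⊗ Z) ↔
      ∀ (c : ℕ) (_hc : 2 ≤ c) (_hcmn : 2 * c ≤ m + n)
        (Φ : ∀ (i j a : ℕ) (r : ℤ) (_hi : 1 ≤ i) (_him : i ≤ m) (_hj : 1 ≤ j) (_hjn : j ≤ n) (_hbY : 0 < Module.finrank ℚ (bettiCohomology Y i)) (_hbZ : 0 < Module.finrank ℚ (bettiCohomology Z j))
          (_hnY : ∀ a', i = 2 * a' → (BettiUniverse.hodge hHD hY (2 * a')).hodgeClasses a' ≠ ⊤) (_hnZ : ∀ b', j = 2 * b' → (BettiUniverse.hodge hHD hZ (2 * b')).hodgeClasses b' ≠ ⊤)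
          (_hij : i + j = 2 * c) (_haj : a + j = 2 * n) (_hr : ((n : ℕ) : ℤ) + r = ((c : ℕ) : ℤ)) (hw : ((i : ℕ) : ℤ) - 2 * r = ((a : ℕ) : ℤ)),
          HodgeStructure.Hom (BettiUniverse.hodge hHD hZ a) (((BettiUniverse.hodge hHD hY i).tateTwist r).cast hw)),
        ∃ γ : bettiCohomology (Y ⊗ Z) (2 * c), ofRatClass (ComplexPoints (Y ⊗ Z)) (2 * c) γ ∈ algebraicClasses (Y ⊗ Z) c ∧
          ∀ (i j a : ℕ) (r : ℤ) (hi : 1 ≤ i) (him : i ≤ m) (hj : 1 ≤ j) (hjn : j ≤ n) (hbY : 0 < Module.finrank ℚ (bettiCohomology Y i)) (hbZ : 0 < Module.finrank ℚ (bettiCohomology Z j))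
            (hnY : ∀ a', i = 2 * a' → (BettiUniverse.hodge hHD hY (2 * a')).hodgeClasses a' ≠ ⊤) (hnZ : ∀ b', j = 2 * b' → (BettiUniverse.hodge hHD hZ (2 * b')).hodgeClasses b' ≠ ⊤)
            (hij : i + j = 2 * c) (haj : a + j = 2 * n) (hab : a + 2 * c = i + 2 * n) (hr : ((n : ℕ) : ℤ) + r = ((c : ℕ) : ℤ)) (hw : ((i : ℕ) : ℤ) - 2 * r = ((a : ℕ) : ℤ)),
            ∀ v, corrAction complexOrientationFamily hY hZ hab (ofRatClass (ComplexPoints (Y ⊗ Z)) (2 * c) γ) (ofRatClass (ComplexPoints Z) a v) =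
              ofRatClass (ComplexPoints Y) i ((Φ i j a r hi him hj hjn hbY hbZ hnY hnZ hij haj hr hw).toLinearMap v) := by
  rw [BettiUniverse.hodgeConjectureFor_tensor_iff_forall_kunneth_reducedWindow_family_exists_algebraic complexOrientationFamily hHD hY hZ hYZ hHCY hHCZ]
  refine forall_congr' fun c ↦ forall_congr' fun _ ↦ forall_congr' fun _ ↦ ?_
  have key := BettiUniverse.joint_corrAction_iff_joint_hom_tateTwist_int hHD hY hZ (c := c)
    (fun j ↦ (1 ≤ j ∧ j ≤ n) ∧ 0 < Module.finrank ℚ (bettiCohomology Z j) ∧ (∀ b', j = 2 * b' → (BettiUniverse.hodge hHD hZ (2 * b')).hodgeClasses b' ≠ ⊤) ∧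
      ∀ i', i' + j = 2 * c → (1 ≤ i' ∧ i' ≤ m) ∧ 0 < Module.finrank ℚ (bettiCohomology Y i') ∧ ∀ a', i' = 2 * a' → (BettiUniverse.hodge hHD hY (2 * a')).hodgeClasses a' ≠ ⊤)
  constructor
  · intro h Φ
    obtain ⟨γ, hγ, hact⟩ := key.1 (fun t ht ↦ (h t ht).imp fun γ hγ ↦ ⟨hγ.1, fun i j a hij haj hab hP ↦
        hγ.2 i j a hij haj hab (hP.2.2.2 i hij).1.1 (hP.2.2.2 i hij).1.2 hP.1.1 hP.1.2 (hP.2.2.2 i hij).2.1 hP.2.1 (hP.2.2.2 i hij).2.2 hP.2.2.1⟩)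
      (fun i j a r hij haj hr hw hP ↦ Φ i j a r (hP.2.2.2 i hij).1.1 (hP.2.2.2 i hij).1.2 hP.1.1 hP.1.2 (hP.2.2.2 i hij).2.1 hP.2.1 (hP.2.2.2 i hij).2.2 hP.2.2.1 hij haj hr hw)
    refine ⟨γ, hγ, fun i j a r hi him hj hjn hbY hbZ hnY hnZ hij haj hab hr hw v ↦ hact i j a r hij haj hab hr hw ⟨⟨hj, hjn⟩, hbZ, hnZ, fun i' hi' ↦ ?_⟩ v⟩
    obtain rfl : i' = i := by omega
    exact ⟨⟨hi, him⟩, hbY, hnY⟩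
  · intro h t ht
    obtain ⟨γ, hγ, hact⟩ := key.2 (fun Φ ↦ (h (fun i j a r hi him hj hjn hbY hbZ hnY hnZ hij haj hr hw ↦ Φ i j a r hij haj hr hw
        ⟨⟨hj, hjn⟩, hbZ, hnZ, fun i' hi' ↦ by obtain rfl : i' = i := (by omega); exact ⟨⟨hi, him⟩, hbY, hnY⟩⟩)).imp fun γ hγ ↦
      ⟨hγ.1, fun i j a r hij haj hab hr hw hP v ↦
        hγ.2 i j a r (hP.2.2.2 i hij).1.1 (hP.2.2.2 i hij).1.2 hP.1.1 hP.1.2 (hP.2.2.2 i hij).2.1 hP.2.1 (hP.2.2.2 i hij).2.2 hP.2.2.1 hij haj hab hr hw v⟩) t ht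
    refine ⟨γ, hγ, fun i j a hij haj hab hi him hj hjn hbY hbZ hnY hnZ ↦ hact i j a hij haj hab ⟨⟨hj, hjn⟩, hbZ, hnZ, fun i' hi' ↦ ?_⟩⟩
    obtain rfl : i' = i := by omega
    exact ⟨⟨hi, him⟩, hbY, hnY⟩

/-! ### §3 With the factors' conjectures on the right-hand side -/

/-- **`HC(Y × Z)` ⟺ `HC(Y)`, `HC(Z)` and the joint reduced-window criterion of §2** (`HC` of a product gives `HC` of the factors: the projections are surjective). [cite: VoisinHodgeI2002, §7.3.2 Lemma 7.28 and Remark 7.29, §11.3.3 Thm. 11.38–11.40, Lemma 11.41 and pp. 285–287]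
[cite: Arapura2006, §4 Lemma 4.2 (clause HC) and §1 Cor. 1.2] [cite: DeligneHodgeII1971, 2.1.13] [cite: Deligne2000, §1] -/
theorem BettiUniverse.hodgeConjectureFor_tensor_iff_factors_and_forall_hom_reducedWindow_family_exists_algebraic (hHD : exists_isReal_hodgeModel) (hY : IsSmoothProjective m Y)
    (hZ : IsSmoothProjective n Z) :
    HodgeConjectureFor (m + n) (Y ⊗ Z) ↔
      HodgeConjectureFor m Y ∧ HodgeConjectureFor n Z ∧
        ∀ (c : ℕ) (_hc : 2 ≤ c) (_hcmn : 2 * c ≤ m + n)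
          (Φ : ∀ (i j a : ℕ) (r : ℤ) (_hi : 1 ≤ i) (_him : i ≤ m) (_hj : 1 ≤ j) (_hjn : j ≤ n) (_hbY : 0 < Module.finrank ℚ (bettiCohomology Y i)) (_hbZ : 0 < Module.finrank ℚ (bettiCohomology Z j))
            (_hnY : ∀ a', i = 2 * a' → (BettiUniverse.hodge hHD hY (2 * a')).hodgeClasses a' ≠ ⊤) (_hnZ : ∀ b', j = 2 * b' → (BettiUniverse.hodge hHD hZ (2 * b')).hodgeClasses b' ≠ ⊤)
            (_hij : i + j = 2 * c) (_haj : a + j = 2 * n) (_hr : ((n : ℕ) : ℤ) + r = ((c : ℕ) : ℤ)) (hw : ((i : ℕ) : ℤ) - 2 * r = ((a : ℕ) : ℤ)),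
            HodgeStructure.Hom (BettiUniverse.hodge hHD hZ a) (((BettiUniverse.hodge hHD hY i).tateTwist r).cast hw)),
          ∃ γ : bettiCohomology (Y ⊗ Z) (2 * c), ofRatClass (ComplexPoints (Y ⊗ Z)) (2 * c) γ ∈ algebraicClasses (Y ⊗ Z) c ∧
            ∀ (i j a : ℕ) (r : ℤ) (hi : 1 ≤ i) (him : i ≤ m) (hj : 1 ≤ j) (hjn : j ≤ n) (hbY : 0 < Module.finrank ℚ (bettiCohomology Y i)) (hbZ : 0 < Module.finrank ℚ (bettiCohomology Z j))
              (hnY : ∀ a', i = 2 * a' → (BettiUniverse.hodge hHD hY (2 * a')).hodgeClasses a' ≠ ⊤) (hnZ : ∀ b', j = 2 * b' → (BettiUniverse.hodge hHD hZ (2 * b')).hodgeClasses b' ≠ ⊤)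
              (hij : i + j = 2 * c) (haj : a + j = 2 * n) (hab : a + 2 * c = i + 2 * n) (hr : ((n : ℕ) : ℤ) + r = ((c : ℕ) : ℤ)) (hw : ((i : ℕ) : ℤ) - 2 * r = ((a : ℕ) : ℤ)),
              ∀ v, corrAction complexOrientationFamily hY hZ hab (ofRatClass (ComplexPoints (Y ⊗ Z)) (2 * c) γ) (ofRatClass (ComplexPoints Z) a v) =
                ofRatClass (ComplexPoints Y) i ((Φ i j a r hi him hj hjn hbY hbZ hnY hnZ hij haj hr hw).toLinearMap v) := by
  refine ⟨fun h ↦ ?_, fun h ↦ (BettiUniverse.hodgeConjectureFor_tensor_iff_forall_hom_reducedWindow_family_exists_algebraic hHD hY hZ (hY.tensor_holds hZ) h.1 h.2.1).2 h.2.2⟩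
  have hHCY : HodgeConjectureFor m Y := hodgeConjectureFor_of_tensor_left hY hZ h
  have hHCZ : HodgeConjectureFor n Z := hodgeConjectureFor_of_tensor_right hY hZ h
  exact ⟨hHCY, hHCZ, (BettiUniverse.hodgeConjectureFor_tensor_iff_forall_hom_reducedWindow_family_exists_algebraic hHD hY hZ (hY.tensor_holds hZ) hHCY hHCZ).1 h⟩

end JointHom

end Literature.AlgebraicGeometry.HodgeTheory

end
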